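import Literature.MathematicalPhysics.QuantumFieldTheory.GaussianQuadraticMGF
import Literature.MathematicalPhysics.PowerSystems.KronReductionGroundedResistance

/-!
# Gaussian weight `e^{−½ vᵀPv}` on `ι → ℝ`: one-coordinate exponential moments, per-coordinate RELATIVE Chernoff tails,
# monotonicity of the inverse form — part (4k-A) of the Laplace SANDWICH toolkit for the orbit average `N_h`
# (T-S5.4 of `Cruxes/BoxWindowHighSU2213/STUB-PLAN-S5U5-STEP1b.md`)

Serves the XL comparison stubs S5 (LINE-19, ⟨stmt-QuantumFields-24004⟩/⟨24335⟩) and U5 (LINE-20, ⟨24336⟩) of the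
critic-PASSed DRAFT lines of planner ym-idea-2; seat ym-line-fcl-p3 g25.  Finite-dimensional real analysis over Mathlib + the
tree's `GaussianQuadraticMGF` / `Beta.GaussianIntegral` (½-convention: weight `e^{−½ vᵀPv}`, mass `√(2π)^{|ι|}/√det P`;
instantiate with `P = 2β·FᵀF`, `F` the Faddeev–Popov operator `fpOperator`).

* §1 `integral_exp_neg_half_quadForm_add_mul_coord`: `∫ e^{−½vᵀPv + u·vᵢ} dv = √(2π)^{|ι|}/√det P · e^{½u²(P⁻¹)ᵢᵢ}`.
* §2 ★ `setIntegral_coord_tail_le` / ★ `setIntegral_exists_coord_tail_le`: the per-coordinate RELATIVE Chernoff tail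
  `∫_{ρ ≤ |vᵢ|} e^{−½vᵀPv} ≤ 2e^{−ρ²/(2(P⁻¹)ᵢᵢ)} · √(2π)^{|ι|}/√det P` and its union bound over `i` (the tail is governed by
  the coordinate's own variance `(P⁻¹)ᵢᵢ`, not by `λ_min(P)`).
* §3 ★ `quadForm_inv_add_le` (`bᵀ(Q+D)⁻¹b ≤ bᵀQ⁻¹b` for `D ⪰ 0`, from the tree's Rayleigh monotonicity `KronReduction.inv_form_le_inv_form_of_form_le`),
  `inv_add_smul_one_diag_le`; scaling utilities `mass_smul`, `inv_smul_of_posDef`.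

HONEST LABEL: helper lemmas for step (1b) of S5/U5; T-S5.4 proper, S5, U5 and the three items are OPEN; the Yang–Mills mass gap
is NOT proved by this file; no summit is proved by a line.
-/

set_option autoImplicit false

noncomputable section

open MeasureTheory Matrix Real

namespace Summit.QuantumFields.YangMills.Theorems.AllWindowsColdBoxBoxHighLine.LaplaceSandwich

open Literature.MathematicalPhysics.QuantumFieldTheory
open Literature.MathematicalPhysics.QuantumFieldTheory.Balaban1983to89.Beta

variable {ι : Type*} [Fintype ι] [DecidableEq ι]

/-! ## §1 Mass and one-coordinate exponential moments of the weight `e^{−½ vᵀPv}` -/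

/-- The quadratic form of `b = u·eᵢ` against a matrix: `(u eᵢ)ᵀ M (u eᵢ) = u² Mᵢᵢ`. [folklore] -/
theorem single_dotProduct_mulVec_single (M : Matrix ι ι ℝ) (i : ι) (u : ℝ) :
    Pi.single i u ⬝ᵥ M *ᵥ Pi.single i u = u ^ 2 * M i i := by
  simp [Matrix.mulVec, dotProduct, Pi.single_apply, Finset.sum_ite_eq', sq, mul_comm, mul_left_comm]

/-- **One-coordinate exponential moment of the Gaussian weight**: for `P` positive definite,
`∫ e^{−½vᵀPv + u·vᵢ} dv = √(2π)^{|ι|}/√det P · e^{½ u² (P⁻¹)ᵢᵢ}` (the tree's completing-the-square identity at `b = u eᵢ`). [folklore] -/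
theorem integral_exp_neg_half_quadForm_add_mul_coord {P : Matrix ι ι ℝ} (hP : P.PosDef) (i : ι) (u : ℝ) :
    ∫ v : ι → ℝ, Real.exp (-(1/2 : ℝ) * (v ⬝ᵥ P *ᵥ v) + u * v i) =
      Real.sqrt (2 * Real.pi) ^ Fintype.card ι / Real.sqrt P.det * Real.exp ((1/2 : ℝ) * (u ^ 2 * P⁻¹ i i)) := by
  have h := integral_exp_neg_half_quadForm_add_dotProduct hP (Pi.single i u)
  rw [single_dotProduct_mulVec_single] at h
  have h1 : ∀ v : ι → ℝ, Pi.single i u ⬝ᵥ v = u * v i := fun v => single_dotProduct v u i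
  simp_rw [h1] at h
  exact h

/-- Integrability of `e^{−½vᵀPv + u·vᵢ}`. [folklore] -/
theorem integrable_exp_neg_half_quadForm_add_mul_coord {P : Matrix ι ι ℝ} (hP : P.PosDef) (i : ι) (u : ℝ) :
    Integrable (fun v : ι → ℝ => Real.exp (-(1/2 : ℝ) * (v ⬝ᵥ P *ᵥ v) + u * v i)) := by
  have h := integrable_exp_neg_half_quadForm_add_dotProduct hP (Pi.single i u)
  have h1 : ∀ v : ι → ℝ, Pi.single i u ⬝ᵥ v = u * v i := fun v => single_dotProduct v u i
  simp_rw [h1] at h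
  exact h

/-- The same integrand written as a product `e^{u vᵢ} · e^{−½vᵀPv}`. [folklore] -/
theorem integral_exp_mul_coord_mul_weight {P : Matrix ι ι ℝ} (hP : P.PosDef) (i : ι) (u : ℝ) :
    ∫ v : ι → ℝ, Real.exp (u * v i) * Real.exp (-(1/2 : ℝ) * (v ⬝ᵥ P *ᵥ v)) =
      Real.sqrt (2 * Real.pi) ^ Fintype.card ι / Real.sqrt P.det * Real.exp ((1/2 : ℝ) * (u ^ 2 * P⁻¹ i i)) := by
  rw [← integral_exp_neg_half_quadForm_add_mul_coord hP i u]
  refine integral_congr_ae (ae_of_all _ fun v => ?_)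
  dsimp only
  rw [← Real.exp_add, add_comm]

/-- Integrability of `e^{u vᵢ} · e^{−½vᵀPv}`. [folklore] -/
theorem integrable_exp_mul_coord_mul_weight {P : Matrix ι ι ℝ} (hP : P.PosDef) (i : ι) (u : ℝ) :
    Integrable (fun v : ι → ℝ => Real.exp (u * v i) * Real.exp (-(1/2 : ℝ) * (v ⬝ᵥ P *ᵥ v))) := by
  refine (integrable_exp_neg_half_quadForm_add_mul_coord hP i u).congr (ae_of_all _ fun v => ?_)
  dsimp only
  rw [← Real.exp_add, add_comm]

/-- The Gaussian mass is positive. [folklore] -/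
theorem mass_pos {P : Matrix ι ι ℝ} (hP : P.PosDef) :
    0 < Real.sqrt (2 * Real.pi) ^ Fintype.card ι / Real.sqrt P.det :=
  div_pos (pow_pos (Real.sqrt_pos.2 (by positivity)) _) (Real.sqrt_pos.2 hP.det_pos)

/-! ## §2 Per-coordinate RELATIVE Chernoff tails -/

/-- Pointwise Chernoff step: on `{ρ ≤ |x|}`, `1 ≤ e^{−uρ}(e^{ux} + e^{−ux})` for `u ≥ 0`. [folklore] -/
theorem one_le_exp_chernoff {u ρ x : ℝ} (hu : 0 ≤ u) (hx : ρ ≤ |x|) :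
    1 ≤ Real.exp (-(u * ρ)) * (Real.exp (u * x) + Real.exp (-u * x)) := by
  rw [neg_mul, mul_add, ← Real.exp_add, ← Real.exp_add]
  rcases le_or_gt 0 x with h0 | h0
  · rw [abs_of_nonneg h0] at hx
    have h1 : 1 ≤ Real.exp (-(u * ρ) + u * x) := Real.one_le_exp (by nlinarith)
    linarith [Real.exp_pos (-(u * ρ) + -(u * x))]
  · rw [abs_of_neg h0] at hx
    have h1 : 1 ≤ Real.exp (-(u * ρ) + -(u * x)) := Real.one_le_exp (by nlinarith)
    linarith [Real.exp_pos (-(u * ρ) + u * x)]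

omit [Fintype ι] [DecidableEq ι] in
/-- The coordinate tail set `{v | ρ ≤ |vᵢ|}` is measurable. [folklore] -/
theorem measurableSet_coord_tail (i : ι) (ρ : ℝ) : MeasurableSet {v : ι → ℝ | ρ ≤ |v i|} :=
  measurableSet_le measurable_const ((measurable_pi_apply i).abs)

/-- ★ **Per-coordinate RELATIVE Chernoff tail of the Gaussian weight**: for `P` positive definite, `ρ ≥ 0` and every
coordinate `i`, `∫_{ρ ≤ |vᵢ|} e^{−½vᵀPv} dv ≤ 2 e^{−ρ²/(2 (P⁻¹)ᵢᵢ)} · √(2π)^{|ι|}/√det P` — the tail is RELATIVE to the full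
mass and governed by the coordinate's own variance `(P⁻¹)ᵢᵢ` (not by `λ_min(P)`). [folklore] -/
theorem setIntegral_coord_tail_le {P : Matrix ι ι ℝ} (hP : P.PosDef) (i : ι) {ρ : ℝ} (hρ : 0 ≤ ρ) :
    ∫ v in {v : ι → ℝ | ρ ≤ |v i|}, Real.exp (-(1/2 : ℝ) * (v ⬝ᵥ P *ᵥ v)) ≤
      2 * Real.exp (-(ρ ^ 2 / (2 * P⁻¹ i i))) * (Real.sqrt (2 * Real.pi) ^ Fintype.card ι / Real.sqrt P.det) := by
  have hσ : 0 < P⁻¹ i i := hP.inv.diag_pos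
  set u : ℝ := ρ / P⁻¹ i i with hu_def
  have hu : 0 ≤ u := div_nonneg hρ hσ.le
  set f : (ι → ℝ) → ℝ := fun v => Real.exp (-(1/2 : ℝ) * (v ⬝ᵥ P *ᵥ v)) with hf_def
  have hf0 : ∀ v, 0 ≤ f v := fun v => (Real.exp_pos _).le
  -- pointwise domination of the indicator
  have hdom : ∀ v : ι → ℝ, {v : ι → ℝ | ρ ≤ |v i|}.indicator f v ≤
      Real.exp (-(u * ρ)) * (Real.exp (u * v i) * f v + Real.exp (-u * v i) * f v) := by
    intro v
    by_cases hv : v ∈ {v : ι → ℝ | ρ ≤ |v i|}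
    · rw [Set.indicator_of_mem hv]
      have h1 := one_le_exp_chernoff hu (x := v i) hv
      have : f v ≤ Real.exp (-(u * ρ)) * (Real.exp (u * v i) + Real.exp (-u * v i)) * f v :=
        le_mul_of_one_le_left (hf0 v) h1
      linarith [this]
    · rw [Set.indicator_of_notMem hv]
      have := hf0 v
      positivity
  have hint : Integrable (fun v : ι → ℝ => Real.exp (-(u * ρ)) * (Real.exp (u * v i) * f v + Real.exp (-u * v i) * f v)) :=
    ((integrable_exp_mul_coord_mul_weight hP i u).add (integrable_exp_mul_coord_mul_weight hP i (-u))).const_mul _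
  rw [← integral_indicator (measurableSet_coord_tail i ρ)]
  calc ∫ v, {v : ι → ℝ | ρ ≤ |v i|}.indicator f v
      ≤ ∫ v : ι → ℝ, Real.exp (-(u * ρ)) * (Real.exp (u * v i) * f v + Real.exp (-u * v i) * f v) :=
        integral_mono_of_nonneg (ae_of_all _ fun v => Set.indicator_nonneg (fun w _ => hf0 w) v) hint (ae_of_all _ hdom)
    _ = Real.exp (-(u * ρ)) * (2 * (Real.sqrt (2 * Real.pi) ^ Fintype.card ι / Real.sqrt P.det *
          Real.exp ((1/2 : ℝ) * (u ^ 2 * P⁻¹ i i)))) := by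
        rw [integral_const_mul, integral_add (integrable_exp_mul_coord_mul_weight hP i u)
          (integrable_exp_mul_coord_mul_weight hP i (-u)), integral_exp_mul_coord_mul_weight hP i u,
          integral_exp_mul_coord_mul_weight hP i (-u), neg_sq]
        ring
    _ = 2 * Real.exp (-(ρ ^ 2 / (2 * P⁻¹ i i))) * (Real.sqrt (2 * Real.pi) ^ Fintype.card ι / Real.sqrt P.det) := by
        have hexp : Real.exp (-(u * ρ)) * Real.exp ((1/2 : ℝ) * (u ^ 2 * P⁻¹ i i)) = Real.exp (-(ρ ^ 2 / (2 * P⁻¹ i i))) := by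
          rw [← Real.exp_add]
          congr 1
          rw [hu_def]
          field_simp
          ring
        calc Real.exp (-(u * ρ)) * (2 * (Real.sqrt (2 * Real.pi) ^ Fintype.card ι / Real.sqrt P.det *
              Real.exp ((1/2 : ℝ) * (u ^ 2 * P⁻¹ i i))))
            = 2 * (Real.exp (-(u * ρ)) * Real.exp ((1/2 : ℝ) * (u ^ 2 * P⁻¹ i i))) *
                (Real.sqrt (2 * Real.pi) ^ Fintype.card ι / Real.sqrt P.det) := by ring
          _ = _ := by rw [hexp]


omit [Fintype ι] [DecidableEq ι] in
/-- The union tail set `{v | ∃ i, ρ ≤ |vᵢ|}` (complement of the open sup-box) is measurable. [folklore] -/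
theorem measurableSet_exists_coord_tail [Countable ι] (ρ : ℝ) : MeasurableSet {v : ι → ℝ | ∃ i, ρ ≤ |v i|} := by
  have : {v : ι → ℝ | ∃ i, ρ ≤ |v i|} = ⋃ i, {v : ι → ℝ | ρ ≤ |v i|} := by ext v; simp
  rw [this]
  exact MeasurableSet.iUnion fun i => measurableSet_coord_tail i ρ

omit [DecidableEq ι] in
/-- Pointwise union bound for indicators of a nonnegative function. [folklore] -/
theorem indicator_exists_le_sum_indicator {f : (ι → ℝ) → ℝ} (hf : ∀ v, 0 ≤ f v) (ρ : ℝ) (v : ι → ℝ) :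
    {v : ι → ℝ | ∃ i, ρ ≤ |v i|}.indicator f v ≤ ∑ i, {v : ι → ℝ | ρ ≤ |v i|}.indicator f v := by
  by_cases hv : v ∈ {v : ι → ℝ | ∃ i, ρ ≤ |v i|}
  · rw [Set.indicator_of_mem hv]
    obtain ⟨i, hi⟩ := hv
    calc f v = {v : ι → ℝ | ρ ≤ |v i|}.indicator f v := (Set.indicator_of_mem (by exact hi) f).symm
      _ ≤ ∑ j, {v : ι → ℝ | ρ ≤ |v j|}.indicator f v :=
          Finset.single_le_sum (f := fun j => {v : ι → ℝ | ρ ≤ |v j|}.indicator f v)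
            (fun j _ => Set.indicator_nonneg (fun w _ => hf w) v) (Finset.mem_univ i)
  · rw [Set.indicator_of_notMem hv]
    exact Finset.sum_nonneg fun j _ => Set.indicator_nonneg (fun w _ => hf w) v

/-- ★ **Union bound: RELATIVE Gaussian mass outside the open sup-box** `{∀ i, |vᵢ| < ρ}`: for `P` positive definite and
`ρ ≥ 0`, `∫_{∃ i, ρ ≤ |vᵢ|} e^{−½vᵀPv} ≤ 2 (Σᵢ e^{−ρ²/(2 (P⁻¹)ᵢᵢ)}) · √(2π)^{|ι|}/√det P`. [folklore] -/
theorem setIntegral_exists_coord_tail_le {P : Matrix ι ι ℝ} (hP : P.PosDef) {ρ : ℝ} (hρ : 0 ≤ ρ) :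
    ∫ v in {v : ι → ℝ | ∃ i, ρ ≤ |v i|}, Real.exp (-(1/2 : ℝ) * (v ⬝ᵥ P *ᵥ v)) ≤
      2 * (∑ i, Real.exp (-(ρ ^ 2 / (2 * P⁻¹ i i)))) * (Real.sqrt (2 * Real.pi) ^ Fintype.card ι / Real.sqrt P.det) := by
  set f : (ι → ℝ) → ℝ := fun v => Real.exp (-(1/2 : ℝ) * (v ⬝ᵥ P *ᵥ v)) with hf_def
  have hf0 : ∀ v, 0 ≤ f v := fun v => (Real.exp_pos _).le
  have hfi : Integrable f := GaussianIntegral.integrable_exp_neg_half_quadForm P hP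
  rw [← integral_indicator (measurableSet_exists_coord_tail ρ)]
  calc ∫ v, {v : ι → ℝ | ∃ i, ρ ≤ |v i|}.indicator f v
      ≤ ∫ v, ∑ i, {v : ι → ℝ | ρ ≤ |v i|}.indicator f v :=
        integral_mono_of_nonneg (ae_of_all _ fun v => Set.indicator_nonneg (fun w _ => hf0 w) v)
          (integrable_finsetSum _ fun i _ => hfi.indicator (measurableSet_coord_tail i ρ))
          (ae_of_all _ (indicator_exists_le_sum_indicator hf0 ρ))
    _ = ∑ i, ∫ v in {v : ι → ℝ | ρ ≤ |v i|}, f v := by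
        rw [integral_finsetSum _ fun i _ => hfi.indicator (measurableSet_coord_tail i ρ)]
        exact Finset.sum_congr rfl fun i _ => integral_indicator (measurableSet_coord_tail i ρ)
    _ ≤ ∑ i, 2 * Real.exp (-(ρ ^ 2 / (2 * P⁻¹ i i))) * (Real.sqrt (2 * Real.pi) ^ Fintype.card ι / Real.sqrt P.det) :=
        Finset.sum_le_sum fun i _ => setIntegral_coord_tail_le hP i hρ
    _ = 2 * (∑ i, Real.exp (-(ρ ^ 2 / (2 * P⁻¹ i i)))) * (Real.sqrt (2 * Real.pi) ^ Fintype.card ι / Real.sqrt P.det) := by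
        rw [Finset.mul_sum, Finset.sum_mul]

omit [DecidableEq ι] in
/-- Measurability of `v ↦ g(vᵢ) · e^{−½vᵀPv}`-type integrands: the weight is continuous. [folklore] -/
theorem continuous_weight (P : Matrix ι ι ℝ) : Continuous fun v : ι → ℝ => Real.exp (-(1/2 : ℝ) * (v ⬝ᵥ P *ᵥ v)) :=
  Real.continuous_exp.comp (continuous_const.mul (continuous_id.dotProduct (continuous_const.matrix_mulVec continuous_id)))

/-- The quadratic form of `P + τ·1`: `vᵀ(P + τ1)v = vᵀPv + τ|v|²`. [folklore] -/
theorem dotProduct_add_smul_one_mulVec (P : Matrix ι ι ℝ) (τ : ℝ) (v : ι → ℝ) :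
    v ⬝ᵥ (P + τ • (1 : Matrix ι ι ℝ)) *ᵥ v = v ⬝ᵥ P *ᵥ v + τ * (v ⬝ᵥ v) := by
  rw [Matrix.add_mulVec, dotProduct_add, Matrix.smul_mulVec, Matrix.one_mulVec, dotProduct_smul, smul_eq_mul]

omit [Fintype ι] in
/-- `P + τ·1` is positive definite for `τ ≥ 0`. [folklore] -/
theorem posDef_add_smul_one {P : Matrix ι ι ℝ} (hP : P.PosDef) {τ : ℝ} (hτ : 0 ≤ τ) :
    (P + τ • (1 : Matrix ι ι ℝ)).PosDef :=
  hP.add_posSemidef (Matrix.PosSemidef.one.smul hτ)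

/-! ## §3 Monotonicity of the inverse form; scaling utilities -/

/-- ★ **The inverse form is antitone**: if `Q` is positive definite and `D` positive semidefinite then
`bᵀ(Q + D)⁻¹b ≤ bᵀQ⁻¹b`. [folklore] -/
theorem quadForm_inv_add_le {Q D : Matrix ι ι ℝ} (hQ : Q.PosDef) (hD : D.PosSemidef) (b : ι → ℝ) :
    b ⬝ᵥ (Q + D)⁻¹ *ᵥ b ≤ b ⬝ᵥ Q⁻¹ *ᵥ b := by
  refine Literature.MathematicalPhysics.PowerSystems.KronReduction.inv_form_le_inv_form_of_form_le hQ
    (hQ.add_posSemidef hD) (fun y => ?_) b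
  have h3 : 0 ≤ y ⬝ᵥ D *ᵥ y := hD.dotProduct_mulVec_nonneg _
  rw [Matrix.add_mulVec, dotProduct_add]
  linarith

/-- ★ Diagonal entries of the inverse decrease under `P ↦ P + τ1` (`τ ≥ 0`): `((P + τ1)⁻¹)ᵢᵢ ≤ (P⁻¹)ᵢᵢ`. [folklore] -/
theorem inv_add_smul_one_diag_le {P : Matrix ι ι ℝ} (hP : P.PosDef) {τ : ℝ} (hτ : 0 ≤ τ) (i : ι) :
    (P + τ • (1 : Matrix ι ι ℝ))⁻¹ i i ≤ P⁻¹ i i := by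
  have h := quadForm_inv_add_le hP (Matrix.PosSemidef.one.smul hτ) (Pi.single i 1)
  rwa [single_dotProduct_mulVec_single, single_dotProduct_mulVec_single, one_pow, one_mul, one_mul] at h

/-- The mass of the scaled precision `c·P` (`c > 0`): `Z(cP) = Z(P)/√c^{|ι|}`. [folklore] -/
theorem mass_smul (P : Matrix ι ι ℝ) {c : ℝ} (hc : 0 < c) :
    Real.sqrt (2 * Real.pi) ^ Fintype.card ι / Real.sqrt (c • P).det =
      (Real.sqrt (2 * Real.pi) ^ Fintype.card ι / Real.sqrt P.det) / Real.sqrt c ^ Fintype.card ι := by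
  have hcn : Real.sqrt (c ^ Fintype.card ι) = Real.sqrt c ^ Fintype.card ι := by
    rw [show c ^ Fintype.card ι = (Real.sqrt c ^ Fintype.card ι) ^ 2 by
      rw [← pow_mul, mul_comm, pow_mul, Real.sq_sqrt hc.le], Real.sqrt_sq (pow_nonneg (Real.sqrt_nonneg _) _)]
  rw [Matrix.det_smul, Real.sqrt_mul (pow_nonneg hc.le _), hcn, div_div, mul_comm (Real.sqrt P.det)]

/-- The inverse of the scaled precision: `(c·P)⁻¹ = c⁻¹·P⁻¹` (`c ≠ 0`, `P` invertible). [folklore] -/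
theorem inv_smul_of_posDef {P : Matrix ι ι ℝ} (hP : P.PosDef) {c : ℝ} (hc : c ≠ 0) :
    (c • P)⁻¹ = c⁻¹ • P⁻¹ := by
  refine Matrix.inv_eq_left_inv ?_
  rw [Matrix.smul_mul, Matrix.mul_smul, smul_smul, inv_mul_cancel₀ hc, one_smul,
    Matrix.nonsing_inv_mul _ ((Matrix.isUnit_iff_isUnit_det _).1 hP.isUnit)]

end Summit.QuantumFields.YangMills.Theorems.AllWindowsColdBoxBoxHighLine.LaplaceSandwich

end
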